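import Summits.CriticalPhenomena.PercolationContinuityZ3.Theorems.PercNearOneGluingNoHeavyLowerTailChampionStability
import Summits.CriticalPhenomena.PercolationContinuityZ3.Theorems.PercNearOneGluingAdditiveGluingOneBond
import Literature.Probability.Percolation.LonelyClusterExchange
import HarnessLib

/-!
# `NoHeavyLowerTail` (stmt-CriticalPhenomena-4575) — OWN-EDGE STABILITY of the lightness champion

Support file (prover `prim-gen-induct`, cumulative-isolation / induction-on-positive-pairs line; `--supports
stmt-CriticalPhenomena-4575`).  No definitions, no named facts, no sorries.

Notation: `μ_w = prodBernoulli w` on `Fin n`, relays `A`, level `j`, `π(x) = {z ∈ A : x ↔ z}`,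
`I_w(x) = μ_w{|π(x)| ≤ j}` (the LIGHTNESS of `x`); a CHAMPION is a relay maximising `I_w` over `A`.

**Theorem (own-edge stability, `CutObserver.lightness_sub_ge_of_erase_edge`,
`champion_of_erase_own_edge`).**  Let `c, x ∈ V`, `x ≠ c`, `v ≠ c` ANY vertex, `e = s(c,v)`, and `w₀ = w[e ↦ 0]`.
If `I_{w₀}(c) ≤ I_{w₀}(x)` then

  `I_w(x) − I_w(c) ≥ (1 − w e) · (I_{w₀}(x) − I_{w₀}(c))`;

in particular, if `w e < 1` and `c` is a champion of `w`, then `c` is a champion of `w₀`: deleting a pair AT the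
champion never dethrones the champion.

Proof.  One-bond decomposition `I_w = (1 − w e) I_{w₀} + (w e) I_{w₀[e ↦ 1]}` (`stub_oneBondDecomp_k15`) and the
GLUED COMPARISON `lightness_glued_le` : `I_{w₀}(c) ≤ I_{w₀}(x) ⇒ I_{w₀[e↦1]}(c) ≤ I_{w₀[e↦1]}(x)`.  For the latter pull
the glued events back along `ω ↦ insert e ω` (`ChampionStability.real_update_one_eq`); on `{x ↔ c or x ↔ v}` the glued
clusters of `x` and `c` carry the same relays, so the two glued events coincide; on `D = {x ↮ c} ∩ {x ↮ v}` the glued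
cluster of `x` is its old cluster and the glued cluster of `c` contains its old cluster, so it remains to see
`μ_{w₀}(D ∩ {|π(c)| ≤ j}) ≤ μ_{w₀}(D ∩ {|π(x)| ≤ j})`.  This is the lonely-cluster exchange
(`Literature.….lonelyClusterExchange_typeMinus`, van den Berg–Häggström–Kahn 2006 Thm 1.5, pair `(x, c)`, the event
`{x ↮ v}` being of type `(−)`) combined with `μ_{w₀}(x ↮ c, |π(c)| ≤ j) ≤ μ_{w₀}(x ↮ c, |π(x)| ≤ j)`, which is the
hypothesis (on `{x ↔ c}` the two lightness events agree).

Role in the line (crux notes BLOBQUOTIENT.md §10–§11, NOTES gen 2): in the champion-shift condition (ML) of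
`…CILInduction` (`setCS_of_ML`), whenever the champion `c` is joined to the light set `S` by a positive pair `e`, one may
take `F = {e}` and `c_F = c`; so (ML) — hence set-champion stability, the cumulative isolation lemma and the crux — is
reduced to champions NOT adjacent to `S` (`…CILInductionNonAdjacent`).  This also proves the candidate lemma CADJ of the
notes in the strong form `d = c`.
-/

noncomputable section

namespace Summit.CriticalPhenomena.PercolationContinuityZ3.Theorems

open MeasureTheory Set Literature.Probability.LatticeModels Literature.Probability.Percolation
open scoped Classical BigOperators

variable {n : ℕ}

namespace CutObserver

open ChampionStability

/-- On `{x ↔ c}` the relay sets of `x` and `c` coincide, so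
`μ{|π(c)| ≤ j} − μ{|π(x)| ≤ j} = μ(x ↮ c, |π(c)| ≤ j) − μ(x ↮ c, |π(x)| ≤ j)`. [folklore] -/
theorem lightness_sub_eq_sep (w : Sym2 (Fin n) → unitInterval) (A : Finset (Fin n)) (c x : Fin n) (j : ℕ) :
    (prodBernoulli w).real {ω : BondConfig (Fin n) | (A.filter fun z => ω ∈ openConn c z).card ≤ j} -
        (prodBernoulli w).real {ω : BondConfig (Fin n) | (A.filter fun z => ω ∈ openConn x z).card ≤ j} =
      (prodBernoulli w).real ((openConn x c : Set (BondConfig (Fin n)))ᶜ ∩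
          {ω : BondConfig (Fin n) | (A.filter fun z => ω ∈ openConn c z).card ≤ j}) -
        (prodBernoulli w).real ((openConn x c : Set (BondConfig (Fin n)))ᶜ ∩
          {ω : BondConfig (Fin n) | (A.filter fun z => ω ∈ openConn x z).card ≤ j}) := by
  set μ := prodBernoulli w with hμ
  set Rc := {ω : BondConfig (Fin n) | (A.filter fun z => ω ∈ openConn c z).card ≤ j} with hRc
  set Rx := {ω : BondConfig (Fin n) | (A.filter fun z => ω ∈ openConn x z).card ≤ j} with hRx
  set D : Set (BondConfig (Fin n)) := (openConn x c : Set (BondConfig (Fin n)))ᶜ with hD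
  have hmeas : ∀ S : Set (BondConfig (Fin n)), MeasurableSet S := fun S => (Set.toFinite S).measurableSet
  -- on `Dᶜ = {x ↔ c}` the two events agree
  have hagree : Rc \ D = Rx \ D := by
    ext ω
    simp only [hRc, hRx, hD, mem_sdiff, mem_compl_iff, not_not, mem_setOf_eq]
    constructor
    · rintro ⟨hcard, hxc⟩
      refine ⟨?_, hxc⟩
      have heq : (A.filter fun z => ω ∈ openConn x z) = (A.filter fun z => ω ∈ openConn c z) :=
        Finset.filter_congr fun z _ =>
          ⟨fun h => (SimpleGraph.Reachable.symm hxc).trans h, fun h => (hxc : (openGraph ω).Reachable x c).trans h⟩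
      rw [heq]; exact hcard
    · rintro ⟨hcard, hxc⟩
      refine ⟨?_, hxc⟩
      have heq : (A.filter fun z => ω ∈ openConn c z) = (A.filter fun z => ω ∈ openConn x z) :=
        Finset.filter_congr fun z _ =>
          ⟨fun h => (hxc : (openGraph ω).Reachable x c).trans h, fun h => (SimpleGraph.Reachable.symm hxc).trans h⟩
      rw [heq]; exact hcard
  have h1 : μ.real Rc = μ.real (Rc ∩ D) + μ.real (Rc \ D) :=
    (measureReal_inter_add_sdiff (hmeas D) (measure_ne_top _ _)).symm
  have h2 : μ.real Rx = μ.real (Rx ∩ D) + μ.real (Rx \ D) :=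
    (measureReal_inter_add_sdiff (hmeas D) (measure_ne_top _ _)).symm
  rw [h1, h2, hagree, inter_comm Rc D, inter_comm Rx D]
  ring

/-- **Separated lightness comparison is stable under a further separation.**  If
`μ(x ↮ c, |π(c)| ≤ j) ≤ μ(x ↮ c, |π(x)| ≤ j)` then for every vertex `v`,
`μ(x ↮ c, x ↮ v, |π(c)| ≤ j) ≤ μ(x ↮ c, x ↮ v, |π(x)| ≤ j)` — the lonely-cluster exchange of van den Berg–Häggström–Kahn
for the pair `(x, c)` with the type-`(−)` event `{x ↮ v}`.
[cite: VandenbergHaggstromKahn2005, Thm. 1.5 (p. 7) — corollary] -/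
theorem sep_lightness_le_inter_not_openConn (w : Sym2 (Fin n) → unitInterval) (A : Finset (Fin n)) (c x v : Fin n)
    (j : ℕ) (hxc : x ≠ c)
    (hle : (prodBernoulli w).real ((openConn x c : Set (BondConfig (Fin n)))ᶜ ∩
          {ω : BondConfig (Fin n) | (A.filter fun z => ω ∈ openConn c z).card ≤ j}) ≤
        (prodBernoulli w).real ((openConn x c : Set (BondConfig (Fin n)))ᶜ ∩
          {ω : BondConfig (Fin n) | (A.filter fun z => ω ∈ openConn x z).card ≤ j})) :
    (prodBernoulli w).real ((openConn x c : Set (BondConfig (Fin n)))ᶜ ∩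
          ({ω : BondConfig (Fin n) | (A.filter fun z => ω ∈ openConn c z).card ≤ j} ∩
            (openConn x v : Set (BondConfig (Fin n)))ᶜ)) ≤
      (prodBernoulli w).real ((openConn x c : Set (BondConfig (Fin n)))ᶜ ∩
          ((openConn x v : Set (BondConfig (Fin n)))ᶜ ∩
            {ω : BondConfig (Fin n) | (A.filter fun z => ω ∈ openConn x z).card ≤ j})) := by
  set μ := prodBernoulli w with hμ
  set Rc := {ω : BondConfig (Fin n) | (A.filter fun z => ω ∈ openConn c z).card ≤ j} with hRc
  set Rx := {ω : BondConfig (Fin n) | (A.filter fun z => ω ∈ openConn x z).card ≤ j} with hRx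
  set D : Set (BondConfig (Fin n)) := (openConn x c : Set (BondConfig (Fin n)))ᶜ with hD
  set B : Set (BondConfig (Fin n)) := (openConn x v : Set (BondConfig (Fin n)))ᶜ with hB
  -- BHK: μ(D ∩ (Rc ∩ B)) · μ(D ∩ Rx) ≤ μ(D ∩ Rc) · μ(D ∩ (B ∩ Rx))
  have key : μ.real (D ∩ (Rc ∩ B)) * μ.real (D ∩ Rx) ≤ μ.real (D ∩ Rc) * μ.real (D ∩ (B ∩ Rx)) :=
    lonelyClusterExchange_typeMinus w hxc A j (B := B) (typeMinus_not_openConn x c v)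
  have hsub : μ.real (D ∩ (Rc ∩ B)) ≤ μ.real (D ∩ Rc) := by
    apply measureReal_mono _ (measure_ne_top _ _)
    exact fun ω hω => ⟨hω.1, hω.2.1⟩
  by_cases h0 : μ.real (D ∩ Rx) = 0
  · -- then `μ(D ∩ Rc) = 0` by the hypothesis, and the left side vanishes
    have hRc0 : μ.real (D ∩ Rc) ≤ 0 := by rw [← h0]; exact hle
    have hl : μ.real (D ∩ (Rc ∩ B)) ≤ 0 := hsub.trans hRc0
    exact hl.trans measureReal_nonneg
  · have hpos : 0 < μ.real (D ∩ Rx) := lt_of_le_of_ne measureReal_nonneg (Ne.symm h0)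
    have h2 : μ.real (D ∩ Rc) * μ.real (D ∩ (B ∩ Rx)) ≤ μ.real (D ∩ Rx) * μ.real (D ∩ (B ∩ Rx)) :=
      mul_le_mul_of_nonneg_right hle measureReal_nonneg
    have h3 : μ.real (D ∩ (Rc ∩ B)) * μ.real (D ∩ Rx) ≤ μ.real (D ∩ (B ∩ Rx)) * μ.real (D ∩ Rx) := by
      calc μ.real (D ∩ (Rc ∩ B)) * μ.real (D ∩ Rx) ≤ μ.real (D ∩ Rc) * μ.real (D ∩ (B ∩ Rx)) := key
        _ ≤ μ.real (D ∩ Rx) * μ.real (D ∩ (B ∩ Rx)) := h2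
        _ = μ.real (D ∩ (B ∩ Rx)) * μ.real (D ∩ Rx) := mul_comm _ _
    exact le_of_mul_le_mul_right h3 hpos

/-- **Glued comparison.**  Let `x ≠ c`, `v ≠ c`, `e = s(c,v)` with `w e = 0`.  If `I_w(c) ≤ I_w(x)` then after GLUING
`c` to `v` (`w[e ↦ 1]`) still `I(c) ≤ I(x)`: on `{x ↔ c or x ↔ v}` (before gluing) the glued relay sets of `x` and
`c` coincide; on `{x ↮ c, x ↮ v}` the glued relay set of `x` is the old one and that of `c` contains the old one, and
there `sep_lightness_le_inter_not_openConn` applies.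
[cite: VandenbergHaggstromKahn2005, Thm. 1.5 (p. 7) — corollary] -/
theorem lightness_glued_le (w : Sym2 (Fin n) → unitInterval) (A : Finset (Fin n)) (c v x : Fin n) (j : ℕ)
    (hcv : c ≠ v) (hxc : x ≠ c) (hw : w s(c, v) = 0)
    (hle : (prodBernoulli w).real {ω : BondConfig (Fin n) | (A.filter fun z => ω ∈ openConn c z).card ≤ j} ≤
      (prodBernoulli w).real {ω : BondConfig (Fin n) | (A.filter fun z => ω ∈ openConn x z).card ≤ j}) :
    (prodBernoulli (Function.update w s(c, v) 1)).real
        {ω : BondConfig (Fin n) | (A.filter fun z => ω ∈ openConn c z).card ≤ j} ≤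
      (prodBernoulli (Function.update w s(c, v) 1)).real
        {ω : BondConfig (Fin n) | (A.filter fun z => ω ∈ openConn x z).card ≤ j} := by
  set μ := prodBernoulli w with hμ
  set Rc := {ω : BondConfig (Fin n) | (A.filter fun z => ω ∈ openConn c z).card ≤ j} with hRc
  set Rx := {ω : BondConfig (Fin n) | (A.filter fun z => ω ∈ openConn x z).card ≤ j} with hRx
  set D : Set (BondConfig (Fin n)) := (openConn x c : Set (BondConfig (Fin n)))ᶜ with hD
  set B : Set (BondConfig (Fin n)) := (openConn x v : Set (BondConfig (Fin n)))ᶜ with hB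
  have hmeas : ∀ S : Set (BondConfig (Fin n)), MeasurableSet S := fun S => (Set.toFinite S).measurableSet
  -- pulled-back events
  set Pc := (fun ω : BondConfig (Fin n) => insert s(c, v) ω) ⁻¹' Rc with hPc
  set Px := (fun ω : BondConfig (Fin n) => insert s(c, v) ω) ⁻¹' Rx with hPx
  rw [real_update_one_eq w hw Rc, real_update_one_eq w hw Rx]
  change μ.real Pc ≤ μ.real Px
  -- the glued separation event `E = {x ↮' c} = D ∩ B`
  set E : Set (BondConfig (Fin n)) := D ∩ B with hE
  have hEiff : ∀ ω : BondConfig (Fin n), ω ∈ E ↔ ¬ (openGraph (insert s(c, v) ω)).Reachable x c := by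
    intro ω
    rw [reachable_insert_to_left_iff ω hcv x]
    simp only [hE, hD, hB, mem_inter_iff, mem_compl_iff, not_or]
    rfl
  -- outside `E` the glued events agree
  have hagree : Pc \ E = Px \ E := by
    ext ω
    simp only [mem_sdiff, hPc, hPx, mem_preimage, hRc, hRx, mem_setOf_eq, hEiff, not_not]
    constructor
    · rintro ⟨hcard, hxc'⟩
      refine ⟨?_, hxc'⟩
      have heq : (A.filter fun z => insert s(c, v) ω ∈ openConn x z) =
          (A.filter fun z => insert s(c, v) ω ∈ openConn c z) :=
        Finset.filter_congr fun z _ => ⟨fun h => hxc'.symm.trans h, fun h => hxc'.trans h⟩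
      rw [heq]; exact hcard
    · rintro ⟨hcard, hxc'⟩
      refine ⟨?_, hxc'⟩
      have heq : (A.filter fun z => insert s(c, v) ω ∈ openConn c z) =
          (A.filter fun z => insert s(c, v) ω ∈ openConn x z) :=
        Finset.filter_congr fun z _ => ⟨fun h => hxc'.trans h, fun h => hxc'.symm.trans h⟩
      rw [heq]; exact hcard
  -- on `E`: the glued event of `c` is inside the old one, the glued event of `x` is the old one
  have hcE : Pc ∩ E ⊆ D ∩ (Rc ∩ B) := by
    rintro ω ⟨hω, hωE⟩
    refine ⟨hωE.1, ?_, hωE.2⟩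
    simp only [hPc, mem_preimage, hRc, mem_setOf_eq] at hω ⊢
    refine le_trans (Finset.card_le_card fun z hz => ?_) hω
    rw [Finset.mem_filter] at hz ⊢
    refine ⟨hz.1, ?_⟩
    have hmono : openGraph ω ≤ openGraph (insert s(c, v) ω) := by
      intro a b hab
      rw [openGraph_adj] at hab ⊢
      exact ⟨Set.mem_insert_of_mem _ hab.1, hab.2⟩
    exact (hz.2 : (openGraph ω).Reachable c z).mono hmono
  have hxE : D ∩ (B ∩ Rx) ⊆ Px ∩ E := by
    rintro ω ⟨hωD, hωB, hω⟩
    refine ⟨?_, hωD, hωB⟩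
    simp only [hPx, mem_preimage, hRx, mem_setOf_eq] at hω ⊢
    have hxc0 : ¬ (openGraph ω).Reachable x c := hωD
    have hxv0 : ¬ (openGraph ω).Reachable x v := hωB
    have heq : (A.filter fun z => insert s(c, v) ω ∈ openConn x z) = (A.filter fun z => ω ∈ openConn x z) :=
      Finset.filter_congr fun z _ => reachable_insert_iff_of_not ω hcv hxc0 hxv0 z
    rw [heq]; exact hω
  -- the separated comparison
  have hsep : μ.real (D ∩ Rc) ≤ μ.real (D ∩ Rx) := by
    have h := lightness_sub_eq_sep w A c x j
    have h' : μ.real Rc - μ.real Rx ≤ 0 := by linarith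
    linarith
  have hkey := sep_lightness_le_inter_not_openConn w A c x v j hxc hsep
  -- assemble
  have h1 : μ.real Pc = μ.real (Pc ∩ E) + μ.real (Pc \ E) :=
    (measureReal_inter_add_sdiff (hmeas E) (measure_ne_top _ _)).symm
  have h2 : μ.real Px = μ.real (Px ∩ E) + μ.real (Px \ E) :=
    (measureReal_inter_add_sdiff (hmeas E) (measure_ne_top _ _)).symm
  rw [h1, h2, hagree]
  have h3 : μ.real (Pc ∩ E) ≤ μ.real (Px ∩ E) :=
    calc μ.real (Pc ∩ E) ≤ μ.real (D ∩ (Rc ∩ B)) := measureReal_mono hcE (measure_ne_top _ _)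
      _ ≤ μ.real (D ∩ (B ∩ Rx)) := hkey
      _ ≤ μ.real (Px ∩ E) := measureReal_mono hxE (measure_ne_top _ _)
  linarith

/-- **Own-edge stability, quantitative form.**  Let `x ≠ c`, `v ≠ c`, `e = s(c,v)`, `w₀ = w[e ↦ 0]`.  If
`I_{w₀}(c) ≤ I_{w₀}(x)` then `(1 − w e)·(I_{w₀}(x) − I_{w₀}(c)) ≤ I_w(x) − I_w(c)`: by the one-bond decomposition and
`lightness_glued_le`. [folklore] -/
theorem lightness_sub_ge_of_erase_edge (w : Sym2 (Fin n) → unitInterval) (A : Finset (Fin n)) (c v x : Fin n)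
    (j : ℕ) (hcv : c ≠ v) (hxc : x ≠ c)
    (hle : (prodBernoulli (Function.update w s(c, v) 0)).real
          {ω : BondConfig (Fin n) | (A.filter fun z => ω ∈ openConn c z).card ≤ j} ≤
        (prodBernoulli (Function.update w s(c, v) 0)).real
          {ω : BondConfig (Fin n) | (A.filter fun z => ω ∈ openConn x z).card ≤ j}) :
    (1 - (w s(c, v) : ℝ)) *
        ((prodBernoulli (Function.update w s(c, v) 0)).real
            {ω : BondConfig (Fin n) | (A.filter fun z => ω ∈ openConn x z).card ≤ j} -
          (prodBernoulli (Function.update w s(c, v) 0)).real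
            {ω : BondConfig (Fin n) | (A.filter fun z => ω ∈ openConn c z).card ≤ j}) ≤
      (prodBernoulli w).real {ω : BondConfig (Fin n) | (A.filter fun z => ω ∈ openConn x z).card ≤ j} -
        (prodBernoulli w).real {ω : BondConfig (Fin n) | (A.filter fun z => ω ∈ openConn c z).card ≤ j} := by
  set e : Sym2 (Fin n) := s(c, v) with he
  set w₀ := Function.update w e 0 with hw₀
  set Rc := {ω : BondConfig (Fin n) | (A.filter fun z => ω ∈ openConn c z).card ≤ j} with hRc
  set Rx := {ω : BondConfig (Fin n) | (A.filter fun z => ω ∈ openConn x z).card ≤ j} with hRx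
  have hw₀e : w₀ s(c, v) = 0 := by simp [hw₀, he]
  have hw₁ : Function.update w e 1 = Function.update w₀ s(c, v) 1 := by
    rw [hw₀, he, Function.update_idem]
  have hglue : (prodBernoulli (Function.update w₀ s(c, v) 1)).real Rc ≤
      (prodBernoulli (Function.update w₀ s(c, v) 1)).real Rx :=
    lightness_glued_le w₀ A c v x j hcv hxc hw₀e hle
  have hp0 : 0 ≤ (w e : ℝ) := (w e).2.1
  rw [stub_oneBondDecomp_k15 n w e Rx, stub_oneBondDecomp_k15 n w e Rc, hw₁]
  have hb : (w e : ℝ) * (prodBernoulli (Function.update w₀ s(c, v) 1)).real Rc ≤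
      (w e : ℝ) * (prodBernoulli (Function.update w₀ s(c, v) 1)).real Rx :=
    mul_le_mul_of_nonneg_left hglue hp0
  linarith

/-- **Own-edge stability of the champion.**  If `c ∈ A` is a level-`j` champion of `w` (`I_w(a) ≤ I_w(c)` for all
`a ∈ A`), `v ≠ c` is any vertex and `w s(c,v) < 1`, then `c` is a champion of `w[s(c,v) ↦ 0]`: deleting a pair at the
champion never dethrones it.  (For `w s(c,v) = 1` and `v` a relay the two glued relays may tie and separate either way.)
[folklore] -/
theorem champion_of_erase_own_edge (w : Sym2 (Fin n) → unitInterval) (A : Finset (Fin n)) (c v : Fin n) (j : ℕ)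
    (hcv : c ≠ v) (hw1 : (w s(c, v) : ℝ) < 1)
    (hchamp : ∀ a ∈ A,
      (prodBernoulli w).real {ω : BondConfig (Fin n) | (A.filter fun z => ω ∈ openConn a z).card ≤ j} ≤
        (prodBernoulli w).real {ω : BondConfig (Fin n) | (A.filter fun z => ω ∈ openConn c z).card ≤ j}) :
    ∀ a ∈ A,
      (prodBernoulli (Function.update w s(c, v) 0)).real
          {ω : BondConfig (Fin n) | (A.filter fun z => ω ∈ openConn a z).card ≤ j} ≤
        (prodBernoulli (Function.update w s(c, v) 0)).real
          {ω : BondConfig (Fin n) | (A.filter fun z => ω ∈ openConn c z).card ≤ j} := by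
  intro a ha
  by_cases hac : a = c
  · rw [hac]
  by_contra hlt
  push Not at hlt
  have h := lightness_sub_ge_of_erase_edge w A c v a j hcv hac hlt.le
  have hpos : 0 < (1 - (w s(c, v) : ℝ)) *
      ((prodBernoulli (Function.update w s(c, v) 0)).real
          {ω : BondConfig (Fin n) | (A.filter fun z => ω ∈ openConn a z).card ≤ j} -
        (prodBernoulli (Function.update w s(c, v) 0)).real
          {ω : BondConfig (Fin n) | (A.filter fun z => ω ∈ openConn c z).card ≤ j}) :=
    mul_pos (by linarith) (by linarith)
  have := hchamp a ha
  linarith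

end CutObserver

end Summit.CriticalPhenomena.PercolationContinuityZ3.Theorems

end
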